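import Summits.QuantumFields.YangMills.Theorems.FluctuationComparisonRegPrIntLS2BetaCornerInTube
import Summits.QuantumFields.YangMills.Theorems.FluctuationComparisonRegPrIntLS2BetaSignedCombSupLipschitz
import HarnessLib

/-!
# S2β · DET-REP (B) — A NON-BASE CORNER'S ROWS FROM CLOSE-BOND-MIN ALONE (the EDGE third's end-to-end knit: COVER ∘ sup-Lipschitz comb ∘ corners in the tube)

Cell `ym3-torus` (rung R3: continuum `SU(2)` Yang–Mills on `T³` — NOT `d = 4`, NOT infinite volume, NOT a mass gap, NOT Clay); seat
`ymfull-r3-prover-4` g0 (R590-ym (a) item (4), DET-REP (B)); definition-free helper of the crux `stmt-QuantumFields-20520`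
(`--supports … --as helper`, NOT a proof of it and NOT a proof of any registered stub).  Registry of record:
`Cruxes/FluctuationComparisonRegPrIntL/Lines/semiclassical_s2beta.lean` v11.4, `def DetRepB` :1072–1098, `def EdgeRows` :1002–1016.

WHAT.  ★★★ `cornerRows_text_of_closeBondMin` — ONE theorem from the displayed kinematic letter to the per-value corner rows of `EdgeRows` at a corner `X`:
given the tube of record through `U₀` read with its COVER row (the (F6′) conjunct of ✓`…S2BetaTubeOfRecordCover.exists_tubeRows_cover`, displayed here as `hF6` over the
tube's own window `UV`) and its positivity row `∀ y ∈ UV, 0 < jV y`, a window chart `c` with the four `ChartRows` clauses (2)(7)(10)(12) at `X`, a minimising live history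
`u ∈ argminHist X` (unfolded), and **CLOSE-BOND-MIN** — a residual `w'` with `‖(w' • u) ℓ − U₀ ℓ‖ ≤ M` on every bond and `(2·d·((Lᵏ−1)∕2)+1)·M` below the fixed chart
thresholds (`< r_C`, `≤ ½`, twice it `< s_C∕2`; `k = K − J`) — THEN `∃ y, y ∈ UV ∧ 0 < jV y ∧ (∀ᶠ v in 𝓝 y, c.jac (X, σ v) ≠ 0) ∧ c.Φ (X, σ y) ∈ Sf ∧ A(c.Φ (X, σ y)) = m X`
— the `hrowA ∕ hrowB` input of ✓`…S2BetaTwoCornerEdge.edgeRows_text_twoCorners` and of ✓`…S2BetaCornerInTube.edgeRows_text_twoCorners_of_pivotAct_eq`.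
= ✓p788715 `qTube_of_bondwiseClose_gaugeAct` (COVER + sup-Lipschitz comb + half-window) then ✓p784096 `cornerRows_text_of_pivotAct_eq`.
So the EDGE third of `def DetRepB` is reduced, in `Theorems/`, to: the tube of record (✓`exists_tubeRows_cover`), EXW∘-existence of the corner minimisers, and CLOSE-BOND-MIN
(interior half ✓`UnitScaleTiltProp7AxialGaugeBlock.dist1_mul_inv_le_interior` in print's axial gauge; inter-block half = the open kinematic letter (β),
[Balaban1985RegularSpaces] Lemma 1 (1.25)–(1.26)).

HONEST SCOPE.  A two-line composition; def-free; default heartbeats; proves nothing of CLOSE-BOND-MIN ∕ (β) ∕ EXW∘ ∕ DETN ∕ JACW ∕ DET-REP (B) ∕ GAP♯ ∕ S2β ∕ the crux 20520;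
finite-volume∕conditional programme; `YM3TorusSU2` NOT proved; rung R3 = SU(2) YM₃ on T³ — NOT d = 4, NOT infinite volume, NOT a mass gap, NOT Clay; the Yang–Mills mass
gap is NOT proved.

References: [Balaban1985Variational] CMP 102 (1985) Thm 1 (8)–(10) p. 279; [Balaban1985RegularSpaces] CMP 99 (1985) Lemma 1 (1.25) p. 79; [Balaban1985Averaging]
CMP 98 (1985) (8) p. 19, §E Prop 6 p. 26–27; [Helgason2000] Ch. I §1 Thm 1.14 p. 96.
-/

noncomputable section

open MeasureTheory Filter Topology Set Function Metric
open scoped Matrix.Norms.L2Operator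
open Literature.MathematicalPhysics.QuantumFieldTheory.Balaban1983to89
open Literature.MathematicalPhysics.QuantumFieldTheory.Balaban1983to89.T3ContinuumYM3Torus
open Literature.MathematicalPhysics.QuantumFieldTheory.Balaban1983to89.HaarExponentialChart
open Literature.MathematicalPhysics.QuantumFieldTheory.Balaban1983to89.T3UnitLawDensityEML
open Literature.MathematicalPhysics.QuantumFieldTheory.Balaban1983to89.T3TiltDescent
open Literature.MathematicalPhysics.QuantumFieldTheory.Balaban1983to89.T3ConstrainedMinimiser (fibre)
open Literature.MathematicalPhysics.QuantumFieldTheory.Balaban1983to89.T4Continuum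
open scoped Literature.MathematicalPhysics.QuantumFieldTheory.Balaban1983to89.T3OrbitAverage
open Summit.QuantumFields.YangMills.Theorems.FluctuationComparisonRegPrIntLWregChain (iterCentralBond)
open Summit.QuantumFields.YangMills.Theorems.FluctuationComparisonRegPrIntLWregGlue (WindowChart)
open Summit.QuantumFields.YangMills.Theorems.FluctuationComparisonRegPrIntLS2BetaResidualSubgroup
open Summit.QuantumFields.YangMills.Theorems.FluctuationComparisonRegPrIntLS2BetaSignedComb (combTransporter)
open Summit.QuantumFields.YangMills.Theorems.FluctuationComparisonRegPrIntLS2BetaSignedCombKill (combSet)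
open Summit.QuantumFields.YangMills.Theorems.FluctuationComparisonRegPrIntLS2BetaCornerInTube (cornerRows_text_of_pivotAct_eq)
open Summit.QuantumFields.YangMills.Theorems.FluctuationComparisonRegPrIntLS2BetaSignedCombSupLipschitz (qTube_of_bondwiseClose_gaugeAct)

namespace Summit.QuantumFields.YangMills.Theorems.FluctuationComparisonRegPrIntLS2BetaCornerOfCloseBondMin

variable (F : T3Family) {J K : ℕ} (hJK : J ≤ K)

/-- ★★★ **THE CORNER ROWS FROM CLOSE-BOND-MIN.**  See the module docstring: COVER (F6′) over the tube's window + positivity of `jV` there + the four `ChartRows` clauses at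
`X` + a minimising live history `u` over `X` + a residual translate `w' • u` bondwise `M`-close to the base `U₀` (with the chart-threshold smallness) ⟹ the per-value corner
rows of LINE g18-1's `EdgeRows` at `(X, y)` for some `y` in the window.
[cite: Balaban1985Variational, Thm 1 (8)-(10) p.279; Balaban1985RegularSpaces, Lemma 1 (1.25) p.79; Balaban1985Averaging, §E Prop 6 p.26-27] -/
theorem cornerRows_text_of_closeBondMin (hk : K - J ≤ (F.P K).m + (F.P K).K)
    {Sf : Set (GaugeField (F.P K) 0 (Matrix.specialUnitaryGroup (Fin 2) ℂ))} {O : Set (GaugeField (F.P J) 0 (Matrix.specialUnitaryGroup (Fin 2) ℂ))}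
    (c : WindowChart F hJK Sf O) (m : GaugeField (F.P J) 0 (Matrix.specialUnitaryGroup (Fin 2) ℂ) → ℝ)
    {X : GaugeField (F.P J) 0 (Matrix.specialUnitaryGroup (Fin 2) ℂ)} {u : GaugeField (F.P K) 0 (Matrix.specialUnitaryGroup (Fin 2) ℂ)}
    (hu : u ∈ fibre F ℰp J K hJK X ∧ u ∈ Sf ∧ wilsonAction4 u = m X)
    (hcarr : ∀ k z, z ∈ {z : GaugeField (F.P K) 0 (Matrix.specialUnitaryGroup (Fin 2) ℂ) | c.jac (X, z) ≠ 0} →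
      pivotAct F hJK (iterCentralBond (P := F.P K) (K - J)) k z ∈ {z : GaugeField (F.P K) 0 (Matrix.specialUnitaryGroup (Fin 2) ℂ) | c.jac (X, z) ≠ 0})
    (hAinv : ∀ k, ∀ z ∈ {z : GaugeField (F.P K) 0 (Matrix.specialUnitaryGroup (Fin 2) ℂ) | c.jac (X, z) ≠ 0},
      wilsonAction4 (c.Φ (X, pivotAct F hJK (iterCentralBond (P := F.P K) (K - J)) k z)) = wilsonAction4 (c.Φ (X, z)))
    (hSinv : ∀ k, ∀ z ∈ {z : GaugeField (F.P K) 0 (Matrix.specialUnitaryGroup (Fin 2) ℂ) | c.jac (X, z) ≠ 0},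
      c.Φ (X, z) ∈ Sf → c.Φ (X, pivotAct F hJK (iterCentralBond (P := F.P K) (K - J)) k z) ∈ Sf)
    (hrec : ∀ U, descendTo F ℰp J K hJK U = X → U ∈ Sf → (c.jac (X, U) ≠ 0 ∧ c.Φ (X, U) = U) ∧
      {z : GaugeField (F.P K) 0 (Matrix.specialUnitaryGroup (Fin 2) ℂ) | c.jac (X, z) ≠ 0} ∈ 𝓝 U)
    {dV : ℕ} {U₀ : GaugeField (F.P K) 0 (Matrix.specialUnitaryGroup (Fin 2) ℂ)}
    {σ : EuclideanSpace ℝ (Fin dV) → GaugeField (F.P K) 0 (Matrix.specialUnitaryGroup (Fin 2) ℂ)} (hσ : Continuous σ)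
    {UV : Set (EuclideanSpace ℝ (Fin dV))} {jV : EuclideanSpace ℝ (Fin dV) → ℝ} (hjV : ∀ y ∈ UV, 0 < jV y)
    (hF6 : ∀ V' : GaugeField (F.P K) 0 (Matrix.specialUnitaryGroup (Fin 2) ℂ),
        (∀ (b : PBond (F.P K) 0) (hb : b ∉ (combSet (K - J) : Set (PBond (F.P K) 0)) ∪ Set.range (iterCentralBond (P := F.P K) (K - J))),
          (combTransporter (K - J) U₀ b.src * U₀ b * (combTransporter (K - J) U₀ b.tgt)⁻¹)⁻¹ *
              (combTransporter (K - J) V' b.src * V' b * (combTransporter (K - J) V' b.tgt)⁻¹) ∈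
            (isChartRep_specialUnitaryGroup (n := Fin 2)).window (IsChartRep.chartRadius (specialUnitaryLogChart (Fin 2)) / 2)) →
        ∃ y ∈ UV, ∃ w : residualSubgroup F hJK,
          (w : Site (F.P K) 0 → Matrix.specialUnitaryGroup (Fin 2) ℂ) = (fun x => (combTransporter (K - J) V' x)⁻¹ * combTransporter (K - J) U₀ x) ∧
          V' = pivotAct F hJK (iterCentralBond (P := F.P K) (K - J))
            (w, fun c => V' (iterCentralBond (P := F.P K) (K - J) c) * (U₀ (iterCentralBond (P := F.P K) (K - J) c))⁻¹) (σ y))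
    (w' : residualSubgroup F hJK) {M : ℝ} (hM0 : 0 ≤ M)
    (hM : ∀ ℓ : PBond (F.P K) 0,
      ‖((GaugeField.gaugeAct (w' : Site (F.P K) 0 → Matrix.specialUnitaryGroup (Fin 2) ℂ) u ℓ : Matrix.specialUnitaryGroup (Fin 2) ℂ) : Matrix (Fin 2) (Fin 2) ℂ) -
        ((U₀ ℓ : Matrix.specialUnitaryGroup (Fin 2) ℂ) : Matrix (Fin 2) (Fin 2) ℂ)‖ ≤ M)
    (hsmall₁ : (2 * ((F.P K).d * (((F.P K).L ^ (K - J) - 1) / 2) : ℕ) + 1) * M < IsChartRep.innerRadius (specialUnitaryLogChart (Fin 2)))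
    (hsmall₂ : (2 * ((F.P K).d * (((F.P K).L ^ (K - J) - 1) / 2) : ℕ) + 1) * M ≤ 1 / 2)
    (hsmall₃ : 2 * ((2 * ((F.P K).d * (((F.P K).L ^ (K - J) - 1) / 2) : ℕ) + 1) * M) < IsChartRep.chartRadius (specialUnitaryLogChart (Fin 2)) / 2) :
    ∃ y : EuclideanSpace ℝ (Fin dV),
      y ∈ UV ∧ 0 < jV y ∧ (∀ᶠ v in 𝓝 y, c.jac (X, σ v) ≠ 0) ∧ c.Φ (X, σ y) ∈ Sf ∧ wilsonAction4 (c.Φ (X, σ y)) = m X := by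
  obtain ⟨k, y, hy, hΘ⟩ := qTube_of_bondwiseClose_gaugeAct F hJK hk hF6 w' hM0 hM hsmall₁ hsmall₂ hsmall₃
  exact ⟨y, cornerRows_text_of_pivotAct_eq F hJK hk c m hu hcarr hAinv hSinv hrec hσ hΘ hy (hjV y hy)⟩

end Summit.QuantumFields.YangMills.Theorems.FluctuationComparisonRegPrIntLS2BetaCornerOfCloseBondMin

end
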